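import Mathlib
import Literature.NumberTheory.EllipticCurves.ThreeIsogeny
import Literature.NumberTheory.EllipticCurves.IsogenyFromRationalMap
import Literature.NumberTheory.EllipticCurves.IsogenyCompProofs
import Literature.NumberTheory.EllipticCurves.IsogenyNotRationalCMProofs
import Literature.NumberTheory.EllipticCurves.MordellCurveSqrtThreeEndomorphism
import Summits.BirchSwinnertonDyer.BirchSwinnertonDyer.Theorems.Rank2ObservatoryThreeIsoIndex

/-!
# Rank-2 observatory — KERNEL-3ISO (A1'): Cohen's dual `3`-isogeny `φ̂ : Ê → E` and `φ̂ ∘ φ = [n]`, `3 ∣ n ≠ 0`, on `ℚ`-points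

HONEST FRAMING: per-curve certified theorems and census instruments; no claim on BSD in rank ≥ 2.

For the Vélu pair `E = E_{m,s} = [0, m², 0, 2ms, s²]` (`threeTorsionModel m s`),
`Ê = [0, m², 0, -18ms, -(27s² + 16m³s)]` (`threeIsogenyCodomain m s`) of the tree's `ThreeIsogeny`:

* `ThreeIso.exists_dualFormula m s`: Cohen's isogeny `φ̂ : Ê → E` (GTM 239, Prop. 8.4.3 for
  `(â, b̂, d̂) = (m, ŝ, -3)`, followed by `(x, y) ↦ (x/9, y/27)`), rewritten in Vélu's coordinate
  `X = x̂ - 4m²/3` and cleared of denominators, as a tree `IsogenyFormula Ê E`: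
  `(X, Y) ↦ (U/h², S·Y/h³)`, `h = 3X + 4m²`, `U = X³ - 36msX - (108s² + 16m³s)`,
  `S = X³ + 4m²X² + 36msX + (216s² - 16m³s)`; the defining identity
  `U³ + m²U²h² + 2msUh⁴ + s²h⁶ = S²·(X³ + m²X² - 18msX - (27s² + 16m³s))` is checked by `ring`.
  The tree's `IsogenyFormula.toIsogeny` (Silverman III.4.8, proved there) makes it an isogeny.
* `ThreeIso.toGeomPoints_pointFun`: the tree's Vélu map on `K`-points (`IsVeluThreePair.pointHom`)
  is the restriction of the isogeny `IsVeluThreePair.toIsogeny` on `K̄`-points.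
* `ThreeIso.exists_dual_pointHom` (**the composite is multiplication by a non-zero multiple of 3**):
  over `ℚ` there are a homomorphism `ψ : Ê(ℚ) →+ E(ℚ)` and `n : ℤ` with `n ≠ 0`, `3 ∣ n`,
  `ψ (φ P) = n • P` for all `P ∈ E(ℚ)`, and `ψ` given by Cohen's formula at every affine
  `Q = (X, Y) ∈ Ê(ℚ)` with `3X + 4m² ≠ 0`. Proof: `φ̂ ∘ φ ∈ End_ℚ(E) = ℤ` by the tree theorem
  `not_hasRationalCM_holds` (no elliptic curve over `ℚ` has rational CM), so `φ̂ ∘ φ = [n]`;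
  `n ≠ 0` as the kernel is finite and `E(ℚ̄)` infinite; `3 ∣ n` as `[n]` kills the point `T = (0, s)`
  of order `3`; Galois descent (`Isogeny.exists_pointHom`) gives `ψ` on `ℚ`-points.
  (In fact `n = ±3`; the divisibility is all the descent bound needs:
  `(E(ℚ) : nE(ℚ)) = |n|^r · #E(ℚ)[n] ≥ 3^(r+1)`.)
* `ThreeIso.three_pow_rank_succ_le_of_zsmul`: the index bound of `Rank2ObservatoryThreeIsoIndex`
  generalised from `ψ ∘ φ = 3` to `ψ ∘ φ = n•`, `3 ∣ n ≠ 0`: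
  `3^(r+1) ≤ #S · #S'` whenever `κ : E(ℚ) → G`, `κ' : Ê(ℚ) → G'` are homomorphisms with
  `ker κ ⊆ Im ψ`, `ker κ' ⊆ Im φ` and images inside the finite sets `S`, `S'`.

## References
* H. Cohen, *Number Theory I*, GTM 239, §8.4, Prop. 8.4.3 (the isogenies `φ`, `φ̂`, `φ̂ ∘ φ = [3]`),
  Prop. 8.2.8. [cite: Cohen2007NumberTheoryI, §8.4 Prop. 8.4.3]
* H. Cohen, F. Pazuki, *Elementary 3-descent with a 3-isogeny*, Acta Arith. 140 (2009), §1–2.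
  [cite: CohenPazuki2009, §2 Prop. 2.2]
* J. Silverman, *AEC*, III.4.8, III.6.1–6.2 (dual isogeny). [cite: SilvermanAEC2009, III.4.8, III.6]
-/

set_option linter.dupNamespace false

noncomputable section

open scoped Classical

namespace Summit.BirchSwinnertonDyer.BirchSwinnertonDyer.Rank2Observatory.ThreeIso

open Literature.NumberTheory.EllipticCurves WeierstrassCurve Polynomial

universe u

/-! ### Cohen's dual isogeny formula -/

section Formula

variable {F : Type u} [Field F]

/-- **Cohen's dual `3`-isogeny `φ̂ : Ê → E` as an isogeny formula** (Prop. 8.4.3, in Vélu's coordinate on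
`Ê`, denominators cleared): there is a tree `IsogenyFormula Ê E` with data `(X, Y) ↦ (U/h², S Y/h³)`,
`h = 3X + 4m²`, `U = X³ - 36msX - (108s² + 16m³s)`, `S = X³ + 4m²X² + 36msX + (216s² - 16m³s)`, `T = 0`
(requires `char F ≠ 3`, so that `h ≠ 0`). Stated as an existence so that no definition is added to the
tree; the identity `U³ + m²U²h² + 2msUh⁴ + s²h⁶ = S²·Ê(X)` is `ring`. [cite: Cohen2007NumberTheoryI, Prop. 8.4.3] -/
theorem exists_dualFormula (m s : F) (h3 : (3 : F) ≠ 0) :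
    ∃ φ : IsogenyFormula (threeIsogenyCodomain m s) (threeTorsionModel m s),
      φ.U = X ^ 3 - C (36 * m * s) * X - C (108 * s ^ 2 + 16 * m ^ 3 * s) ∧
      φ.h = C 3 * X + C (4 * m ^ 2) ∧
      φ.S = X ^ 3 + C (4 * m ^ 2) * X ^ 2 + C (36 * m * s) * X + C (216 * s ^ 2 - 16 * m ^ 3 * s) ∧
      φ.T = 0 := by
  refine ⟨{ U := X ^ 3 - C (36 * m * s) * X - C (108 * s ^ 2 + 16 * m ^ 3 * s)
            h := C 3 * X + C (4 * m ^ 2)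
            S := X ^ 3 + C (4 * m ^ 2) * X ^ 2 + C (36 * m * s) * X + C (216 * s ^ 2 - 16 * m ^ 3 * s)
            T := 0
            identity₁ := by simp [threeIsogenyCodomain, threeTorsionModel]
            identity₀ := ?_
            h_ne_zero := ?_
            natDegree_lt := ?_ }, rfl, rfl, rfl, rfl⟩
  · simp only [threeIsogenyCodomain, threeTorsionModel, map_zero, zero_mul, mul_zero, add_zero,
      zero_pow two_ne_zero, C_mul, C_pow, C_neg, C_add, C_sub, map_ofNat]
    ring
  · intro h0
    have := congr_arg (fun p => p.coeff 1) h0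
    simp only [coeff_add, coeff_C_mul, coeff_X_one, mul_one, coeff_C, if_neg one_ne_zero, add_zero,
      coeff_zero] at this
    exact h3 this
  · have hU : (X ^ 3 - C (36 * m * s) * X - C (108 * s ^ 2 + 16 * m ^ 3 * s) : F[X]).natDegree = 3 := by
      compute_degree!
    have hh : ((C 3 * X + C (4 * m ^ 2)) ^ 2 : F[X]).natDegree ≤ 2 := by
      calc ((C 3 * X + C (4 * m ^ 2)) ^ 2 : F[X]).natDegree
          ≤ 2 * (C 3 * X + C (4 * m ^ 2) : F[X]).natDegree := natDegree_pow_le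
        _ ≤ 2 * 1 := by
          gcongr
          compute_degree
        _ = 2 := by norm_num
    rw [hU]; omega

variable {m s : F} {φ : IsogenyFormula (threeIsogenyCodomain m s) (threeTorsionModel m s)}

/-- `h(X) = 3X + 4m²` evaluated. [folklore] -/
theorem h_eval_of (hh : φ.h = C 3 * X + C (4 * m ^ 2)) (a : F) : φ.h.eval a = 3 * a + 4 * m ^ 2 := by
  simp [hh]

/-- `U` evaluated. [folklore] -/
theorem U_eval_of (hU : φ.U = X ^ 3 - C (36 * m * s) * X - C (108 * s ^ 2 + 16 * m ^ 3 * s)) (a : F) :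
    φ.U.eval a = a ^ 3 - 36 * m * s * a - (108 * s ^ 2 + 16 * m ^ 3 * s) := by
  simp [hU]

/-- `S` evaluated. [folklore] -/
theorem S_eval_of
    (hS : φ.S = X ^ 3 + C (4 * m ^ 2) * X ^ 2 + C (36 * m * s) * X + C (216 * s ^ 2 - 16 * m ^ 3 * s))
    (a : F) :
    φ.S.eval a = a ^ 3 + 4 * m ^ 2 * a ^ 2 + 36 * m * s * a + (216 * s ^ 2 - 16 * m ^ 3 * s) := by
  simp [hS]

/-- `h` of the formula read over `K̄`, at a `K`-rational argument. [folklore] -/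
theorem geom_h_eval_of (hh : φ.h = C 3 * X + C (4 * m ^ 2)) (a : F) :
    φ.geom.h.eval (algebraMap F (AlgebraicClosure F) a) =
      algebraMap F (AlgebraicClosure F) (3 * a + 4 * m ^ 2) := by
  rw [IsogenyFormula.geom, IsogenyFormula.map_h, eval_map, eval₂_at_apply, h_eval_of hh]

/-- The `x`-coordinate of the formula read over `K̄`, at a `K`-rational argument. [folklore] -/
theorem geom_valX_of (hU : φ.U = X ^ 3 - C (36 * m * s) * X - C (108 * s ^ 2 + 16 * m ^ 3 * s))
    (hh : φ.h = C 3 * X + C (4 * m ^ 2)) (a : F) :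
    φ.geom.valX (algebraMap F (AlgebraicClosure F) a) =
      algebraMap F (AlgebraicClosure F)
        ((a ^ 3 - 36 * m * s * a - (108 * s ^ 2 + 16 * m ^ 3 * s)) / (3 * a + 4 * m ^ 2) ^ 2) := by
  rw [IsogenyFormula.valX, IsogenyFormula.geom, IsogenyFormula.map_U, IsogenyFormula.map_h, eval_map,
    eval₂_at_apply, eval_map, eval₂_at_apply, U_eval_of hU, h_eval_of hh, map_div₀, map_pow]

/-- The `y`-coordinate of the formula read over `K̄`, at `K`-rational arguments. [folklore] -/
theorem geom_valY_of
    (hS : φ.S = X ^ 3 + C (4 * m ^ 2) * X ^ 2 + C (36 * m * s) * X + C (216 * s ^ 2 - 16 * m ^ 3 * s))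
    (hT : φ.T = 0) (hh : φ.h = C 3 * X + C (4 * m ^ 2)) (a b : F) :
    φ.geom.valY (algebraMap F (AlgebraicClosure F) a) (algebraMap F (AlgebraicClosure F) b) =
      algebraMap F (AlgebraicClosure F)
        ((a ^ 3 + 4 * m ^ 2 * a ^ 2 + 36 * m * s * a + (216 * s ^ 2 - 16 * m ^ 3 * s)) * b /
          (3 * a + 4 * m ^ 2) ^ 3) := by
  rw [IsogenyFormula.valY, IsogenyFormula.geom, IsogenyFormula.map_S, IsogenyFormula.map_T,
    IsogenyFormula.map_h, hT, Polynomial.map_zero, eval_zero, add_zero, eval_map,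
    eval₂_at_apply, eval_map, eval₂_at_apply, S_eval_of hS, h_eval_of hh, map_div₀, map_mul, map_pow]

end Formula

/-! ### The Vélu map on `K`-points is the isogeny on `K̄`-points -/

section Compat

variable {K : Type u} [Field K] {m s : K} {W W' : WeierstrassCurve K}

/-- The tree's three-isogeny on `K`-points (`pointFun`/`pointHom`) agrees with the isogeny
`toIsogeny` on `K̄`-points under `E(K) ↪ E(K̄)`. [folklore] -/
theorem toGeomPoints_pointFun (h : IsVeluThreePair m s W W') (P : W.toAffine.Point) :
    W'.toGeomPoints (h.pointFun P) = h.toIsogeny (W.toGeomPoints P) := by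
  rw [IsVeluThreePair.toIsogeny_apply]
  rcases P with _ | ⟨x, y, hxy⟩
  · rw [← Affine.Point.zero_def, h.pointFun_zero, map_zero, map_zero]; rfl
  · set ι := algebraMap K (AlgebraicClosure K) with hι
    have h1 := SqrtThree.nonsingular_algebraMap W hxy
    rw [SqrtThree.toGeomPoints_some' W hxy h1 rfl rfl]
    by_cases hx : x = 0
    · have hιx : ι x = 0 := by rw [hx, map_zero]
      rw [h.pointFun_some_of_eq_zero _ hx, map_zero, h.geom.pointFun_some_of_eq_zero _ hιx]; rfl
    · have hιx : ι x ≠ 0 := (map_ne_zero ι).mpr hx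
      rw [h.pointFun_some _ hx, h.geom.pointFun_some _ hιx]
      have h2 := SqrtThree.nonsingular_algebraMap W' (h.nonsingular_image hxy hx)
      rw [SqrtThree.toGeomPoints_some' W' (h.nonsingular_image hxy hx) h2 rfl rfl]
      exact SqrtThree.some_eq_some
        (by simp [IsVeluThreePair.X, hι, map_div₀, map_ofNat])
        (by simp [IsVeluThreePair.Y, hι, map_div₀, map_ofNat])

/-- The same for `pointHom`. [folklore] -/
theorem toGeomPoints_pointHom (h : IsVeluThreePair m s W W') (P : W.toAffine.Point) :
    W'.toGeomPoints (h.pointHom P) = h.toIsogeny (W.toGeomPoints P) := by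
  rw [IsVeluThreePair.pointHom_apply]; exact toGeomPoints_pointFun h P

end Compat

/-! ### Over `ℚ`: the composite `φ̂ ∘ φ` is `[n]`, `3 ∣ n ≠ 0` -/

section Rational

/-- The value of Cohen's `φ̂` at a good affine point is nonsingular on `E`. [folklore] -/
theorem nonsingular_dual_value {m s : ℚ} (h : IsVeluThreePair m s (threeTorsionModel m s)
    (threeIsogenyCodomain m s)) {X Y : ℚ}
    (hQ : (threeIsogenyCodomain m s).toAffine.Nonsingular X Y) (hX : 3 * X + 4 * m ^ 2 ≠ 0) :
    (threeTorsionModel m s).toAffine.Nonsingular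
      ((X ^ 3 - 36 * m * s * X - (108 * s ^ 2 + 16 * m ^ 3 * s)) / (3 * X + 4 * m ^ 2) ^ 2)
      ((X ^ 3 + 4 * m ^ 2 * X ^ 2 + 36 * m * s * X + (216 * s ^ 2 - 16 * m ^ 3 * s)) * Y /
        (3 * X + 4 * m ^ 2) ^ 3) := by
  haveI : (threeTorsionModel m s).IsElliptic := ⟨isUnit_iff_ne_zero.mpr h.Δ_ne⟩
  have h3 : (3 : ℚ) ≠ 0 := by norm_num
  obtain ⟨φ, hU, hh, hS, hT⟩ := exists_dualFormula m s h3
  have hx : φ.h.eval X ≠ 0 := by rwa [h_eval_of hh]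
  have := φ.nonsingular_val hQ.left hx
  simp only [IsogenyFormula.valX, IsogenyFormula.valY, U_eval_of hU, h_eval_of hh, S_eval_of hS, hT,
    eval_zero, add_zero] at this
  exact this

/-- **`φ̂ ∘ φ = [n]` with `3 ∣ n ≠ 0`, on `ℚ`-points, `φ̂` explicit.** For the Vélu pair
`(E, Ê) = (threeTorsionModel m s, threeIsogenyCodomain m s)` over `ℚ` there are a homomorphism
`ψ : Ê(ℚ) →+ E(ℚ)` and an integer `n ≠ 0` divisible by `3` such that `ψ (φ P) = n • P` for every
`P ∈ E(ℚ)` (`φ` = Vélu's `pointHom`), and `ψ(X, Y) = (U(X)/h(X)², S(X) Y/h(X)³)` (Cohen's `φ̂`,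
Prop. 8.4.3) at every affine `(X, Y) ∈ Ê(ℚ)` with `h(X) = 3X + 4m² ≠ 0`. The integrality
`φ̂ ∘ φ ∈ ℤ` is `End_ℚ(E) = ℤ` (tree theorem `not_hasRationalCM_holds`); `3 ∣ n` because the composite
kills `T = (0, s)` of order `3`; `n ≠ 0` because its kernel is finite.
[cite: Cohen2007NumberTheoryI, Prop. 8.4.3] -/
theorem exists_dual_pointHom [DecidableEq ℚ] {m s : ℚ} (h : IsVeluThreePair m s (threeTorsionModel m s)
    (threeIsogenyCodomain m s)) :
    ∃ (ψ : (threeIsogenyCodomain m s).toAffine.Point →+ (threeTorsionModel m s).toAffine.Point)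
      (n : ℤ), n ≠ 0 ∧ 3 ∣ n ∧ (∀ P, ψ (h.pointHom P) = n • P) ∧
      ∀ (X Y : ℚ) (hQ : (threeIsogenyCodomain m s).toAffine.Nonsingular X Y)
        (hX : 3 * X + 4 * m ^ 2 ≠ 0),
        ψ (.some X Y hQ) = .some _ _ (nonsingular_dual_value h hQ hX) := by
  -- bridge the `DecidableEq ℚ` instance of the statement to the classical one of the tree lemmas
  obtain rfl : ‹DecidableEq ℚ› = fun a b ↦ Classical.propDecidable (a = b) :=
    Subsingleton.elim _ _
  letI instDecEqRat : DecidableEq ℚ := fun a b ↦ Classical.propDecidable (a = b)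
  haveI hE : (threeTorsionModel m s).IsElliptic := ⟨isUnit_iff_ne_zero.mpr h.Δ_ne⟩
  haveI hE' : (threeIsogenyCodomain m s).IsElliptic := ⟨isUnit_iff_ne_zero.mpr h.Δ'_ne⟩
  haveI : CharZero (AlgebraicClosure ℚ) :=
    charZero_of_injective_algebraMap (algebraMap ℚ (AlgebraicClosure ℚ)).injective
  have h3 : (3 : ℚ) ≠ 0 := by norm_num
  obtain ⟨φd, hU, hh, hS, hT⟩ := exists_dualFormula m s h3
  -- the two isogenies and their composite
  set φg : Isogeny (threeTorsionModel m s) (threeIsogenyCodomain m s) := h.toIsogeny with hφg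
  set ψg : Isogeny (threeIsogenyCodomain m s) (threeTorsionModel m s) := φd.toIsogeny with hψg
  set χ : Isogeny (threeTorsionModel m s) (threeTorsionModel m s) := ψg.comp φg with hχ
  -- `End_ℚ(E) = ℤ`: `χ = [n]`
  have hmem := χ.toAddMonoidHom_mem_endRing
  have hnoCM := not_hasRationalCM_holds (threeTorsionModel m s)
  simp only [HasRationalCM, not_exists, not_and, not_forall, not_not] at hnoCM
  obtain ⟨n, hn⟩ := hnoCM _ hmem
  have hχn : ∀ P : (threeTorsionModel m s).geomPoints, ψg (φg P) = n • P := fun P => by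
    have := congr_arg (fun f : AddMonoid.End (threeTorsionModel m s).geomPoints => f P) hn
    simp only [AddMonoid.End.intCast_apply] at this
    exact this
  -- `n ≠ 0`: the kernel of `χ` is finite, `E(ℚ̄)` is infinite
  have hn0 : n ≠ 0 := by
    intro h0
    apply Set.infinite_univ (α := (threeTorsionModel m s).geomPoints)
    refine χ.finite_ker.subset fun P _ => ?_
    show χ.toAddMonoidHom P = 0
    rw [Isogeny.coe_toAddMonoidHom, hχ, Isogeny.comp_apply, hχn, h0, zero_smul]
  -- `3 ∣ n`: `χ(T) = φ̂(φ T) = φ̂(O) = O` and `T` has order `3`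
  have h3n : 3 ∣ n := by
    haveI : Fact (Nat.Prime 3) := ⟨Nat.prime_three⟩
    have h3T : (3 : ℕ) • h.T = 0 := by
      rw [succ_nsmul, two_nsmul, h.T_add_T, neg_add_cancel]
    have hT3 : addOrderOf ((threeTorsionModel m s).toGeomPoints h.T) = 3 := by
      rw [addOrderOf_injective (threeTorsionModel m s).toGeomPoints
        (threeTorsionModel m s).toGeomPoints_injective h.T]
      exact addOrderOf_eq_prime h3T h.T_ne_zero
    have hkill : n • (threeTorsionModel m s).toGeomPoints h.T = 0 := by
      rw [← hχn, ← toGeomPoints_pointHom h h.T, IsVeluThreePair.pointHom_apply,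
        IsVeluThreePair.pointFun_T, map_zero, map_zero]
    have := (addOrderOf_dvd_iff_zsmul_eq_zero).mpr hkill
    rw [hT3] at this
    exact_mod_cast this
  -- descend `φ̂` to `ℚ`-points
  obtain ⟨ψ, hψ⟩ := ψg.exists_pointHom
  refine ⟨ψ, n, hn0, h3n, fun P => ?_, fun X Y hQ hX => ?_⟩
  · apply (threeTorsionModel m s).toGeomPoints_injective
    rw [hψ, toGeomPoints_pointHom, hχn, map_zsmul]
  · apply (threeTorsionModel m s).toGeomPoints_injective
    rw [hψ]
    have h1 := SqrtThree.nonsingular_algebraMap (threeIsogenyCodomain m s) hQ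
    have h2 := SqrtThree.nonsingular_algebraMap (threeTorsionModel m s) (nonsingular_dual_value h hQ hX)
    rw [SqrtThree.toGeomPoints_some' (threeIsogenyCodomain m s) hQ h1 rfl rfl,
      SqrtThree.toGeomPoints_some' (threeTorsionModel m s) _ h2 rfl rfl]
    have hx := (geom_h_eval_of hh X).trans_ne ((_root_.map_ne_zero _).mpr hX)
    rw [hψg, φd.toIsogeny_some h1 hx]
    exact SqrtThree.some_eq_some (geom_valX_of hU hh X) (geom_valY_of hS hT hh X Y)

end Rational

/-! ### The index bound with `ψ ∘ φ = n•`, `3 ∣ n ≠ 0` -/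

section Index

/-- `3 ≤ #A[N]` when `A` has a point `T ≠ 0` with `3T = 0` and `3 ∣ N`. [folklore] -/
theorem three_le_natCard_torsionBy_of_dvd {A : Type*} [AddCommGroup A] (T : A) (hT : 3 • T = 0)
    (hT0 : T ≠ 0) (N : ℕ) (hN : 3 ∣ N) [Finite (AddSubgroup.torsionBy A (N : ℤ))] :
    3 ≤ Nat.card (AddSubgroup.torsionBy A (N : ℤ)) := by
  haveI : Fact (Nat.Prime 3) := ⟨Nat.prime_three⟩
  have hmem : T ∈ AddSubgroup.torsionBy A (N : ℤ) := by
    obtain ⟨k, rfl⟩ := hN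
    rw [AddSubgroup.torsionBy.nsmul_iff, mul_comm, ← smul_smul, hT, smul_zero]
  have hord : addOrderOf (⟨T, hmem⟩ : AddSubgroup.torsionBy A (N : ℤ)) = 3 := by
    rw [← addOrderOf_injective (AddSubgroup.torsionBy A (N : ℤ)).subtype Subtype.val_injective,
      AddSubgroup.subtype_apply]
    exact addOrderOf_eq_prime hT hT0
  have hdvd := addOrderOf_dvd_natCard (⟨T, hmem⟩ : AddSubgroup.torsionBy A (N : ℤ))
  rw [hord] at hdvd
  exact Nat.le_of_dvd Nat.card_pos hdvd

/-- Negating a homomorphism does not change its range. [folklore] -/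
theorem range_neg_eq {A B : Type*} [AddCommGroup A] [AddCommGroup B] (ψ : B →+ A) :
    (-ψ).range = ψ.range := by
  ext x
  simp only [AddMonoidHom.mem_range, AddMonoidHom.neg_apply]
  constructor
  · rintro ⟨b, hb⟩; exact ⟨-b, by rw [map_neg, hb]⟩
  · rintro ⟨b, hb⟩; exact ⟨-b, by rw [map_neg, hb, neg_neg]⟩

/-- **`3^{r+1} ≤ #S · #S'` with `ψ ∘ φ = [n]`, `3 ∣ n ≠ 0`** (the form delivered by `exists_dual_pointHom`):
for `E` elliptic over a number field `K`, `Γ = E(K)` of rank `r`, `φ : Γ → B`, `ψ : B → Γ` additive with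
`ψ (φ P) = n • P`, a point `T ∈ Γ` of order `3`, and additive `κ : Γ → G`, `κ' : B → G'` with
`ker κ ⊆ ψ(B)`, `ker κ' ⊆ φ(Γ)` valued in finite sets `S`, `S'`:
`3^(r+1) ≤ |n|^r · #Γ[n] = (Γ : nΓ) ≤ (Γ : ψ(B)) (B : φ(Γ)) ≤ #S · #S'`.
[cite: Cohen2007NumberTheoryI, §8.4 (Prop. 8.4.8) and Prop. 8.2.8] [cite: CohenPazuki2009, Prop. 2.2] -/
theorem three_pow_mordellWeilRank_succ_le_of_zsmul {K : Type*} [Field K] [NumberField K]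
    (W : WeierstrassCurve K) [W.IsElliptic] {B G G' : Type*} [AddCommGroup B] [AddCommGroup G]
    [AddCommGroup G'] (φ : W.toAffine.Point →+ B) (ψ : B →+ W.toAffine.Point) (n : ℤ) (hn0 : n ≠ 0)
    (h3n : 3 ∣ n) (hψφ : ∀ P, ψ (φ P) = n • P)
    (T : W.toAffine.Point) (hT : 3 • T = 0) (hT0 : T ≠ 0)
    (κ : W.toAffine.Point →+ G) (κ' : B →+ G') (hκ : κ.ker ≤ ψ.range) (hκ' : κ'.ker ≤ φ.range)
    (S : Finset G) (S' : Finset G') (hS : ∀ P, κ P ∈ S) (hS' : ∀ Q, κ' Q ∈ S') :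
    3 ^ (W.mordellWeilRank + 1) ≤ S.card * S'.card := by
  -- replace `ψ` by `±ψ` so that `ψ' ∘ φ = N•`, `N = |n|`
  set N := n.natAbs with hN
  haveI : NeZero N := ⟨Int.natAbs_ne_zero.mpr hn0⟩
  have h3N : 3 ∣ N := Int.ofNat_dvd_left.mp (by exact_mod_cast h3n)
  obtain ⟨ψ', hψ'φ, hrange⟩ : ∃ ψ' : B →+ W.toAffine.Point, (∀ P, ψ' (φ P) = N • P) ∧
      ψ'.range = ψ.range := by
    rcases Int.natAbs_eq n with hpos | hneg
    · refine ⟨ψ, fun P => ?_, rfl⟩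
      rw [hψφ, ← natCast_zsmul]
      exact congrArg (· • P) hpos
    · refine ⟨-ψ, fun P => ?_, range_neg_eq ψ⟩
      rw [AddMonoidHom.neg_apply, hψφ, ← natCast_zsmul, ← neg_zsmul]
      exact congrArg (· • P) (by omega : -n = (n.natAbs : ℤ))
  rw [← hrange] at hκ
  set TN := AddSubgroup.torsionBy W.toAffine.Point (N : ℤ) with hTN
  haveI : Module.Finite ℤ W.toAffine.Point := W.module_finite_point_holds
  haveI : Finite TN := finite_torsionBy_of_moduleFinite W.toAffine.Point N
  -- `(Γ : NΓ) = N^r · #Γ[N]`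
  have hcount : (nsmulAddMonoidHom N : W.toAffine.Point →+ W.toAffine.Point).range.index =
      N ^ W.mordellWeilRank * Nat.card TN := by
    rw [AddSubgroup.index_eq_card]
    exact natCard_quotient_nsmulRange_point_eq W N
  have hidx := index_nsmulRange_mul_relIndex_eq N φ ψ' hψ'φ
  obtain ⟨hψ0, hψS⟩ := index_ne_zero_and_le_card ψ'.range κ hκ S hS
  obtain ⟨hφ0, hφS⟩ := index_ne_zero_and_le_card φ.range κ' hκ' S' hS'
  have hrel : φ.range.relIndex ψ'.ker ≠ 0 := by
    intro h0
    rw [h0, mul_zero] at hidx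
    exact mul_ne_zero hψ0 hφ0 hidx.symm
  have htor : 3 ≤ Nat.card TN := three_le_natCard_torsionBy_of_dvd T hT hT0 N h3N
  have h3leN : 3 ≤ N := Nat.le_of_dvd (Nat.pos_of_ne_zero (NeZero.ne N)) h3N
  calc 3 ^ (W.mordellWeilRank + 1) = 3 ^ W.mordellWeilRank * 3 := pow_succ _ _
    _ ≤ N ^ W.mordellWeilRank * Nat.card TN :=
        Nat.mul_le_mul (Nat.pow_le_pow_left h3leN _) htor
    _ = (nsmulAddMonoidHom N : W.toAffine.Point →+ W.toAffine.Point).range.index := hcount.symm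
    _ ≤ (nsmulAddMonoidHom N : W.toAffine.Point →+ W.toAffine.Point).range.index *
          φ.range.relIndex ψ'.ker := Nat.le_mul_of_pos_right _ (Nat.pos_of_ne_zero hrel)
    _ = ψ'.range.index * φ.range.index := hidx
    _ ≤ S.card * S'.card := Nat.mul_le_mul hψS hφS

/-- The rank reading with `ψ ∘ φ = [n]`: `#S · #S' < 3 ^ (s + 2)` gives `rank E(K) ≤ s`.
[cite: CohenPazuki2009, Prop. 2.2] -/
theorem mordellWeilRank_le_of_card_mul_card_lt_of_zsmul {K : Type*} [Field K] [NumberField K]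
    (W : WeierstrassCurve K) [W.IsElliptic] {B G G' : Type*} [AddCommGroup B] [AddCommGroup G]
    [AddCommGroup G'] (φ : W.toAffine.Point →+ B) (ψ : B →+ W.toAffine.Point) (n : ℤ) (hn0 : n ≠ 0)
    (h3n : 3 ∣ n) (hψφ : ∀ P, ψ (φ P) = n • P)
    (T : W.toAffine.Point) (hT : 3 • T = 0) (hT0 : T ≠ 0)
    (κ : W.toAffine.Point →+ G) (κ' : B →+ G') (hκ : κ.ker ≤ ψ.range) (hκ' : κ'.ker ≤ φ.range)
    (S : Finset G) (S' : Finset G') (hS : ∀ P, κ P ∈ S) (hS' : ∀ Q, κ' Q ∈ S') (s : ℕ)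
    (hs : S.card * S'.card < 3 ^ (s + 2)) : W.mordellWeilRank ≤ s := by
  have h := three_pow_mordellWeilRank_succ_le_of_zsmul W φ ψ n hn0 h3n hψφ T hT hT0 κ κ' hκ hκ' S S'
    hS hS'
  have hlt : 3 ^ (W.mordellWeilRank + 1) < 3 ^ (s + 2) := lt_of_le_of_lt h hs
  have := (Nat.pow_lt_pow_iff_right (by norm_num : 1 < 3)).mp hlt
  omega

end Index

end Summit.BirchSwinnertonDyer.BirchSwinnertonDyer.Rank2Observatory.ThreeIso

end
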